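import Summits.BirchSwinnertonDyer.BirchSwinnertonDyer.Theorems.PrintCf2RamifiedOffTYZTwoPrimesByName
import Summits.BirchSwinnertonDyer.BirchSwinnertonDyer.Theorems.PrintCf2RamifiedOffTYZGenusPeriodNormCriterion
import Summits.BirchSwinnertonDyer.BirchSwinnertonDyer.Theorems.PrintCf2RamifiedOffTYZGenusPointHalfTraceClass
import HarnessLib

/-!
# WORKFILE (crux stmt-BirchSwinnertonDyer-20509 `RamifiedOffTYZOfFacts`, line `offtyz-v7`, LEAD cruxlead-20509 g26, cycle 27) —
# THE GENUS-PERIOD LAWS OF R2 AS TYPED CONJECTURES, in the BY-NAME currency of cycle 27, with the proved compositions «law ⟹ C⁺ on its row class»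

Status: CONJECTURES typed for the planner / the disprover / the next lead; `def … : Prop` only because this is a crux WORKFILE
(`Cruxes/RamifiedOffTYZOfFacts/Lines/`), never a Theorems/Literature proposal.  Nothing here is asserted.  Companion of g23's
`Lines/offtyz_v7_LevelTwoOddSectors.lean` (Selmer-side conjectures F1-R2 `PartnerLawR2`, K-R2-CT `LevelTwoJumpLawR2`; analytic-side
`LevelTwoGenusFormulaR2` in 𝓛-currency).  THIS file types the analytic side in GENUS-PERIOD currency — the object the U-road (CM values of the
level-32 modular units `x, x ∓ 2i` on `X₀(32) ≅ A`, g19 §4) must evaluate — using the cycle-27 theorems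
(`Theorems/PrintCf2RamifiedOffTYZTwoPrimesByName.lean`, p788929; `…PrimeBlockDigits.lean`, p787913; display `tyz_genusPointBlockData`, p788254),
which leave NO display-shaped or parity hypothesis: every law below quantifies only over named facts' objects (the display package `D` of
[TianYuanZhang2017] §3) and the row's structural bits.

R2 = { n = lq : l ≡ 1, q ≡ 7 (mod 8) primes, (l/q) = (q/l) = 1 }, jump-one rows: ord_{s=1} L(E_n,s) = 1, #Sel₂(E_n) = 2⁵, #Sel₄(E_n) = 2⁶.
Row classes (census g17, 122 rows n ≤ 2·10⁴; all laws 0 exceptions there):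
* PARTNER-TRIVIAL (`Ш(A_{lq})[2] = 0`; ⟹ ρ(lq) = 1, #Sel₄ = 2⁶ automatic — g20 T1; census: exactly the rows l ≠ x² + 32y², 78/122):
  law GP0-R2 «Z(lq) ∉ 2A(ℍ′) + tors» (depth 0).  Kernel: C⁺ on the class ⟺ GP0-R2 (`levelTwo_iff_genusPeriod_not_twoDivisible_of_partner_R2`).
* ρ = 0, INVISIBLE generator (d(h) = 2; census 12/122, all with l = x² + 32y²), digit ¬δ(l) (ord L(E_l) ≥ 2, or = 0 with #Sel₄(E_l) ≠ 2⁴):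
  law GP1-R2 «depth Z(lq) = 1 exactly».  Kernel: C⁺ ⟺ GP1-R2 (`levelTwo_iff_genusPeriod_depth_eq_one`).
* ρ = 0, invisible, δ(l): law GP1δ-R2 «Z ∈ 2A + tors ∧ Z − α_q ∉ 4A + tors» (census: no such jump row observed — F1-R2 predicts δ(l)-rows are
  partner-trivial, hence ρ = 1; typed for completeness).  Kernel: C⁺ ⟺ GP1δ-R2 (`levelTwo_iff_genusPeriod_depth`).
* ρ = 0, VISIBLE generator (d(h) ∈ {l, 2l}; census 27/122): law GPv-R2 «[Z(lq)] = [Q₁]» (layer one; K1: κ(Z(lq)) ≡ (1,[π_l]) mod κ(T)).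
  Kernel: C⁺ ⟺ GPv-R2 (`levelTwo_two_primes_iff_visible`).
rev 2 (same cycle): + the U-ROAD TARGET as a typed statement — `NormNonsquareLawR2` («the Φ-norm of the CM value `x(z_{lq}) − 2i` avoids the six torsion
square-classes in `M`», read on the seven-block display `tyz_sevenBlockCMData`, p789756) and the kernel composition «NormNonsquareLawR2 ⟹ C⁺ on the
visible R2 rows» through `Theorems/PrintCf2RamifiedOffTYZGenusPeriodNormCriterion.lean` (p790211).
rev 3: + the R1 twin `HalfProductNonsquareLawR1` (the Φ₀-half-product of `x(z_n^t) − 2i` INSIDE `ℍ′_n`, on the displayed CM layer of the five-block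
`n = lm`) with the composition «⟹ GP0-R1: `Z(lm) ∉ 2A(ℍ′_n) + tors`» through `Theorems/PrintCf2RamifiedOffTYZGenusPointHalfTraceClass.lean` (p790517).
BSD is not proved by any of this; no class is closed by this file; 20509 / 23431 / 23432 OPEN.
-/

noncomputable section

open scoped Classical

open WeierstrassCurve WeierstrassCurve.Affine WeierstrassCurve.Affine.Point
  Literature.NumberTheory.EllipticCurves Literature.NumberTheory.EllipticCurves.Rank1Residual
  Summit.BirchSwinnertonDyer.Rank1Residual
  Literature.NumberTheory.EllipticCurves.TianYuanZhang2017
  Literature.NumberTheory.EllipticCurves.TianYuanZhang2017.W2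
  Summit.BirchSwinnertonDyer.PrintCf2.TwoPrimesByName
  Literature.NumberTheory.EllipticCurves.TianYuanZhang2017.GenusPointData

set_option autoImplicit false

namespace Summit.BirchSwinnertonDyer.PrintCf2.LevelTwo.GenusPeriodLaws

/-! ## §1 The laws (CONJECTURES; beyond print — CM values of level-32 modular units at depth ≤ 2) -/

/-- **CONJECTURE GP0-R2 (partner-trivial half of R2): the genus period is NOT 2-divisible.**  For primes `l ≡ 1`, `q ≡ 7 (mod 8)` with
`(l/q) = (q/l) = 1`, `ord_{s=1} L(E_{lq},s) = 1`, `#Sel₂(E_{lq}) = 2⁵`, `Ш(A_{lq})[2] = 0`, and every display package `D` of `lq` (TYZ §3 with the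
CM-point layer and Thm 3.5 at blocks): `Z(lq) ∉ 2A(ℍ′_{lq}) + tors`.  (Census: the 78 rows `l ≠ x² + 32y²` of g17's table, `[Z] ≠ 0` on all.) -/
def GenusPeriodDepthZeroLawR2 : Prop :=
  ∀ (l q : ℕ) [Fact l.Prime] [Fact q.Prime],
    l % 8 = 1 → q % 8 = 7 → IsSquare ((l : ℤ) : ZMod q) → IsSquare ((q : ℤ) : ZMod l) →
    (congruentNumberCurve (l * q)).analyticRank = 1 →
    Nat.card ((congruentNumberCurve (l * q)).selmerGroup 2) = 2 ^ 5 →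
    (∀ c ∈ (congruentNumberCurve (l * q)).twoIsogenyCodomain.sha, 2 • c = 0 → c = 0) →
    ∀ D : GenusPointData (l * q), D.Printed → D.CMPointCompositumPrinted → D.Thm35AtBlocks →
      ¬ ∃ y : APoint D.H, IsOfFinAddOrder (D.Z (l * q) - (2 : ℤ) • y)

/-- **CONJECTURE GP1-R2 (invisible `ρ = 0` rows, digit `¬δ(l)`): the genus period has depth EXACTLY ONE.**  For primes `l ≡ 1`, `q ≡ 7 (mod 8)`,
`n = lq` with `ord_{s=1} L(E_n,s) = 1`, `#Sel₂(E_n) = 2⁵`, `#Sel₄(E_n) = 2⁶`, `ρ(n) = 0`, an `A_n`-generator of shape `(2s², Y)`, `¬δ(l)`, and every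
display package `D`: `Z(lq) ∈ 2A + tors ∧ Z(lq) ∉ 4A + tors`.  (Census: 12 invisible rows, depth Z = 1 on all.) -/
def GenusPeriodDepthOneLawR2 : Prop :=
  ∀ (l q : ℕ), l.Prime → q.Prime → l % 8 = 1 → q % 8 = 7 →
    (congruentNumberCurve (l * q)).analyticRank = 1 →
    Nat.card ((congruentNumberCurve (l * q)).selmerGroup 2) = 2 ^ 5 →
    Nat.card ((congruentNumberCurve (l * q)).selmerGroup 4) = 2 ^ 6 →
    (rhoSubgroup (l * q)).index = 1 →
    ∀ {X Y : ℚ} (h : (Atwo (l * q)).toAffine.Nonsingular X Y) {s : ℚ}, s ≠ 0 → X = 2 * s ^ 2 →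
      (∀ P : (Atwo (l * q)).toAffine.Point, ∃ m : ℤ, IsOfFinAddOrder (P - m • (Point.some X Y h : (Atwo (l * q)).toAffine.Point))) →
      ¬ ((congruentNumberCurve l).analyticRank = 0 ∧ Nat.card ((congruentNumberCurve l).selmerGroup 4) = 2 ^ 4) →
      ∀ D : GenusPointData (l * q), D.Printed → D.CMPointCompositumPrinted → D.Thm35AtBlocks →
        (∃ y : APoint D.H, IsOfFinAddOrder (D.Z (l * q) - (2 : ℤ) • y)) ∧
          ¬ ∃ y : APoint D.H, IsOfFinAddOrder (D.Z (l * q) - (4 : ℤ) • y)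

/-! ## §2 Proved compositions: each law IS C⁺ on its row class (cycle-27 theorems, nothing else) -/

section Compositions

/-- **GP0-R2 ⟹ C⁺ on the partner-trivial half of R2** (granted GZK and conjuncts 2, 4, 5 of 𝔅_ram, read on any display package). -/
theorem levelTwoScriptLExact_partnerHalf_of_law (hLaw : GenusPeriodDepthZeroLawR2)
    (hGZK : rank_eq_analyticRank_of_analyticRank_le_one) (hmod : WeierstrassCurve.hasEntireLFunction_rat)
    (hCM0 : bsdTriple_of_hasCM_of_L_one_ne_zero) (h12 : thm12_parity_of_scriptL') (hT : tyz_genusPointBlockData)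
    {l q : ℕ} [hlp : Fact l.Prime] [hqp : Fact q.Prime]
    (hl8 : l % 8 = 1) (hq8 : q % 8 = 7) (hlq : IsSquare ((l : ℤ) : ZMod q)) (hql : IsSquare ((q : ℤ) : ZMod l))
    (hr1 : (congruentNumberCurve (l * q)).analyticRank = 1)
    (h₂ : Nat.card ((congruentNumberCurve (l * q)).selmerGroup 2) = 2 ^ 5)
    (hA : ∀ c ∈ (congruentNumberCurve (l * q)).twoIsogenyCodomain.sha, 2 • c = 0 → c = 0) :
    ∀ L : ℤ, IsScriptL (l * q) L → (2 : ℤ) ∣ L ∧ ¬ (4 : ℤ) ∣ L := by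
  obtain ⟨hsq, h7, -⟩ := RankZeroDigitDepthTwo.sector_R2 hlp.out hqp.out hl8 hq8 (rfl : l * q = l * q)
  obtain ⟨D, hPr, hC, hBl⟩ := hT (l * q) hsq (Or.inr (Or.inr h7))
  exact (levelTwo_iff_genusPeriod_not_twoDivisible_of_partner_R2 hGZK hmod hCM0 h12 hl8 hq8 hlq hql hr1 h₂ hA D hPr hC hBl).mpr
    (hLaw l q hl8 hq8 hlq hql hr1 h₂ hA D hPr hC hBl)

/-- **GP1-R2 ⟹ C⁺ on the invisible `¬δ` rows of R2** (granted GZK and conjuncts 2, 4, 5 of 𝔅_ram). -/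
theorem levelTwoScriptLExact_invisible_of_law (hLaw : GenusPeriodDepthOneLawR2)
    (hGZK : rank_eq_analyticRank_of_analyticRank_le_one) (hmod : WeierstrassCurve.hasEntireLFunction_rat)
    (hCM0 : bsdTriple_of_hasCM_of_L_one_ne_zero) (h12 : thm12_parity_of_scriptL') (hT : tyz_genusPointBlockData)
    {l q : ℕ} (hl : l.Prime) (hq : q.Prime) (hl8 : l % 8 = 1) (hq8 : q % 8 = 7)
    (hr : (congruentNumberCurve (l * q)).analyticRank = 1)
    (h₂ : Nat.card ((congruentNumberCurve (l * q)).selmerGroup 2) = 2 ^ 5)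
    (h₄ : Nat.card ((congruentNumberCurve (l * q)).selmerGroup 4) = 2 ^ 6)
    (hρ : (rhoSubgroup (l * q)).index = 1)
    {X Y : ℚ} (h : (Atwo (l * q)).toAffine.Nonsingular X Y) {s : ℚ} (hs : s ≠ 0) (hX : X = 2 * s ^ 2)
    (hgen : ∀ P : (Atwo (l * q)).toAffine.Point, ∃ m : ℤ, IsOfFinAddOrder (P - m • (Point.some X Y h : (Atwo (l * q)).toAffine.Point)))
    (hδ : ¬ ((congruentNumberCurve l).analyticRank = 0 ∧ Nat.card ((congruentNumberCurve l).selmerGroup 4) = 2 ^ 4)) :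
    ∀ L : ℤ, IsScriptL (l * q) L → (2 : ℤ) ∣ L ∧ ¬ (4 : ℤ) ∣ L := by
  obtain ⟨hsq, h7, -⟩ := RankZeroDigitDepthTwo.sector_R2 hl hq hl8 hq8 (rfl : l * q = l * q)
  obtain ⟨D, hPr, hC, hBl⟩ := hT (l * q) hsq (Or.inr (Or.inr h7))
  exact (levelTwo_iff_genusPeriod_depth_eq_one hGZK hmod hCM0 h12 hl hq hl8 hq8 rfl hr D hPr hC hBl hρ h hs hX hgen hδ).mpr
    (hLaw l q hl hq hl8 hq8 hr h₂ h₄ hρ h hs hX hgen hδ D hPr hC hBl)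

/-- **Conversely C⁺ (item 23431) ⟹ GP1-R2** — the law is EXACTLY the invisible-`¬δ` content of C⁺ (no slack). -/
theorem law_of_levelTwoScriptLExact
    (hC' : ∀ (n : ℕ) [(congruentNumberCurve n).IsElliptic] [(congruentNumberCurve n).IsGloballyMinimal],
      Squarefree n → (n % 8 = 5 ∨ n % 8 = 6 ∨ n % 8 = 7) → (congruentNumberCurve n).analyticRank = 1 →
      Nat.card ((congruentNumberCurve n).selmerGroup 2) = 2 ^ 5 → Nat.card ((congruentNumberCurve n).selmerGroup 4) = 2 ^ 6 →
      ∀ L : ℤ, IsScriptL n L → (2 : ℤ) ∣ L ∧ ¬ (4 : ℤ) ∣ L)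
    (hGZK : rank_eq_analyticRank_of_analyticRank_le_one) (hmod : WeierstrassCurve.hasEntireLFunction_rat)
    (hCM0 : bsdTriple_of_hasCM_of_L_one_ne_zero) (h12 : thm12_parity_of_scriptL') : GenusPeriodDepthOneLawR2 := by
  intro l q hl hq hl8 hq8 hr h₂ h₄ hρ X Y h s hs hX hgen hδ D hPr hC hBl
  obtain ⟨hsq, h7, -⟩ := RankZeroDigitDepthTwo.sector_R2 hl hq hl8 hq8 (rfl : l * q = l * q)
  haveI := isElliptic_congruentNumberCurve hsq.ne_zero
  haveI := isGloballyMinimal_congruentNumberCurve hsq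
  exact (levelTwo_iff_genusPeriod_depth_eq_one hGZK hmod hCM0 h12 hl hq hl8 hq8 rfl hr D hPr hC hBl hρ h hs hX hgen hδ).mp
    (hC' (l * q) hsq (Or.inr (Or.inr h7)) hr h₂ h₄)

end Compositions


/-! ## §3 (rev 2) The U-road target as a typed statement: the Φ-norm of `x(z) − 2i` avoids the torsion classes -/

/-- **CONJECTURE N-R2 (the U-road target, beyond print — CM values of the level-32 unit `x − 2i`):** for primes `l ≡ 1`, `q ≡ 7 (mod 8)`, `n = lq`, and
every display package `D` of `n` with seven-block data `(M, ι, z = (x₀,y₀), Φ)` at `d = n` ((S1)–(S2) of `CMPointSevenBlockDisplays`) on a VISIBLE row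
(`ord L(E_n) = 1`, an `A_n`-generator with `X ∉ 2ℚ^{×2}`): the Φ-norm `N = ∏_{t∈Φ}(t x₀ − 2i)` has `N·w` a NON-square in `M` for each of the six torsion
classes `w ∈ {1, −2i, −8, −4i, 2 − 2i, −2 − 2i}`.  (Census K1, g19: `κ(Z(lq)) ≡ (1, [π_l])` mod `κ(T)` on these rows.) -/
def NormNonsquareLawR2 : Prop :=
  ∀ (n l q : ℕ), l.Prime → q.Prime → l % 8 = 1 → q % 8 = 7 → n = l * q →
    (congruentNumberCurve n).analyticRank = 1 →
    ∀ (D : GenusPointData n) (M : Type) (_ : Field M) (_ : NumberField M) (_ : IsGalois ℚ M) (ι : D.H →ₐ[ℚ] M) (x₀ y₀ : M)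
      (h₀ : (curveA.baseChange M).toAffine.Nonsingular x₀ y₀) (Φ : Finset (M ≃ₐ[ℚ] M)),
      D.Printed → D.CMPointCompositumPrinted → D.Thm35AtBlocks →
      Point.map (W' := curveA) ι (D.Z n) = ∑ t ∈ Φ, galPtOver M t (.some x₀ y₀ h₀) →
      (∀ t ∈ Φ, ¬ ((2 : ℕ) • galPtOver M t (.some x₀ y₀ h₀) = 0 ∨ (2 : ℕ) • galPtOver M t (.some x₀ y₀ h₀) = tauOne)) →
      ∀ {X Y : ℚ} (h : (Atwo n).toAffine.Nonsingular X Y), (¬ ∃ s : ℚ, X = 2 * s ^ 2) →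
        (∀ P : (Atwo n).toAffine.Point, ∃ m : ℤ, IsOfFinAddOrder (P - m • (Point.some X Y h : (Atwo n).toAffine.Point))) →
        ∀ w ∈ ({1, -(2 * ι D.im), -8, -(4 * ι D.im), 2 - 2 * ι D.im, -2 - 2 * ι D.im} : Finset M),
          ¬ IsSquare ((∏ t ∈ Φ, ((t : M ≃ₐ[ℚ] M) x₀ - 2 * ι D.im)) * w)

/-- **N-R2 ⟹ C⁺ on the visible rows of R2** (granted conjuncts 1, 2, 4, 5 of 𝔅_ram; kernel: part 7 `genusPeriod_not_twoDivisible_of_norm` + part 4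
`levelTwo_iff_genusPeriod_not_twoDivisible_of_visible`), read on ANY display package with seven-block data at `d = n`. -/
theorem levelTwoScriptLExact_visible_of_normLaw (hLaw : NormNonsquareLawR2)
    (hGZK : rank_eq_analyticRank_of_analyticRank_le_one) (hmod : WeierstrassCurve.hasEntireLFunction_rat)
    (hCM0 : bsdTriple_of_hasCM_of_L_one_ne_zero) (h12 : thm12_parity_of_scriptL')
    {n l q : ℕ} (hl : l.Prime) (hq : q.Prime) (hl8 : l % 8 = 1) (hq8 : q % 8 = 7) (hn : n = l * q)
    (hr : (congruentNumberCurve n).analyticRank = 1)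
    (D : GenusPointData n) (hPr : D.Printed) (hC : D.CMPointCompositumPrinted) (hBl : D.Thm35AtBlocks)
    {M : Type} [Field M] [NumberField M] [IsGalois ℚ M] (ι : D.H →ₐ[ℚ] M) {x₀ y₀ : M}
    (h₀ : (curveA.baseChange M).toAffine.Nonsingular x₀ y₀) (Φ : Finset (M ≃ₐ[ℚ] M))
    (hS1 : Point.map (W' := curveA) ι (D.Z n) = ∑ t ∈ Φ, galPtOver M t (.some x₀ y₀ h₀))
    (hS2 : ∀ t ∈ Φ, ¬ ((2 : ℕ) • galPtOver M t (.some x₀ y₀ h₀) = 0 ∨ (2 : ℕ) • galPtOver M t (.some x₀ y₀ h₀) = tauOne))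
    {X Y : ℚ} (h : (Atwo n).toAffine.Nonsingular X Y) (hX : ¬ ∃ s : ℚ, X = 2 * s ^ 2)
    (hgen : ∀ P : (Atwo n).toAffine.Point, ∃ m : ℤ, IsOfFinAddOrder (P - m • (Point.some X Y h : (Atwo n).toAffine.Point))) :
    ∀ L : ℤ, IsScriptL n L → (2 : ℤ) ∣ L ∧ ¬ (4 : ℤ) ∣ L := by
  have hmod8 : n % 8 = 7 := by rw [hn, Nat.mul_mod, hl8, hq8]
  have hodd : Odd n := Nat.odd_iff.mpr (by omega)
  have hns := hLaw n l q hl hq hl8 hq8 hn hr D M inferInstance inferInstance inferInstance ι x₀ y₀ h₀ Φ hPr hC hBl hS1 hS2 h hX hgen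
  have hnot := GenusPeriodNormCriterion.genusPeriod_not_twoDivisible_of_norm D hodd hPr.2.2.2.2.2.2.2.2.1 ι h₀ Φ hS1 hS2 hns
  exact (GenusPeriodR2.levelTwo_iff_genusPeriod_not_twoDivisible_of_visible hGZK hmod hCM0 h12 hl hq hl8 hq8 hn hr D hPr hC hBl h hX
    hgen).mpr hnot


/-! ## §4 (rev 3) The R1 twin: the half-product of `x(z_n^t) − 2i` inside `ℍ′_n` -/

/-- **CONJECTURE N-R1 (beyond print):** for primes `l ≡ 1`, `m ≡ 5 (mod 8)`, `n = lm` with `ord_{s=1} L(E_n,s) = 1`, `#Sel₂(E_n) = 2⁵`, `#Sel₄(E_n) = 2⁶`,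
every display package `D` (`Printed` + CM-point layer) and every presentation `Z(n) = Σ_{t∈Φ} z^t` of its genus point by a displayed CM point `z = (x₀, y₀)`
with `#Φ = g(n)` and no `z^t` a cusp, on a VISIBLE row (`X(h) ∉ 2ℚ^{×2}`): `(∏_{t∈Φ}(t x₀ − 2i))·w` is a non-square in `ℍ′_n` for the six torsion
classes `w`.  (Its conclusion through part 8 is the layer-one law GP0-R1 «`Z(lm) ∉ 2A(ℍ′_n) + tors`».) -/
def HalfProductNonsquareLawR1 : Prop :=
  ∀ (n l m : ℕ), l.Prime → m.Prime → l % 8 = 1 → m % 8 = 5 → n = l * m →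
    (congruentNumberCurve n).analyticRank = 1 →
    Nat.card ((congruentNumberCurve n).selmerGroup 2) = 2 ^ 5 → Nat.card ((congruentNumberCurve n).selmerGroup 4) = 2 ^ 6 →
    ∀ (D : GenusPointData n), D.Printed → D.CMPointCompositumPrinted →
    ∀ {x₀ y₀ : D.H} (h₀ : (curveA.baseChange D.H).toAffine.Nonsingular x₀ y₀) (Φ : Finset (D.H ≃ₐ[ℚ] D.H)),
      D.Z n = ∑ t ∈ Φ, D.galPt t (.some x₀ y₀ h₀) → Φ.card = gK n →
      (∀ t ∈ Φ, ¬ ((2 : ℕ) • D.galPt t (.some x₀ y₀ h₀) = 0 ∨ (2 : ℕ) • D.galPt t (.some x₀ y₀ h₀) = tauOne)) →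
      ∀ {X Y : ℚ} (h : (Atwo n).toAffine.Nonsingular X Y), (¬ ∃ s : ℚ, X = 2 * s ^ 2) →
        (∀ P : (Atwo n).toAffine.Point, ∃ m : ℤ, IsOfFinAddOrder (P - m • (Point.some X Y h : (Atwo n).toAffine.Point))) →
        ∀ w ∈ ({1, -(2 * D.im), -8, -(4 * D.im), 2 - 2 * D.im, -2 - 2 * D.im} : Finset D.H),
          ¬ IsSquare ((∏ t ∈ Φ, ((t : D.H ≃ₐ[ℚ] D.H) x₀ - 2 * D.im)) * w)

/-- **N-R1 ⟹ GP0-R1 («`Z(lm) ∉ 2A(ℍ′_n) + tors`») on the visible jump-one rows of R1** (kernel: part 8 `genusPoint_not_twoDivisible_of_prod`). -/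
theorem genusPoint_not_twoDivisible_R1_of_halfProductLaw (hLaw : HalfProductNonsquareLawR1)
    {n l m : ℕ} (hl : l.Prime) (hm : m.Prime) (hl8 : l % 8 = 1) (hm8 : m % 8 = 5) (hn : n = l * m)
    (hr : (congruentNumberCurve n).analyticRank = 1)
    (h₂ : Nat.card ((congruentNumberCurve n).selmerGroup 2) = 2 ^ 5) (h₄ : Nat.card ((congruentNumberCurve n).selmerGroup 4) = 2 ^ 6)
    (D : GenusPointData n) (hPr : D.Printed) (hC : D.CMPointCompositumPrinted)
    {x₀ y₀ : D.H} (h₀ : (curveA.baseChange D.H).toAffine.Nonsingular x₀ y₀) (Φ : Finset (D.H ≃ₐ[ℚ] D.H))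
    (hG1 : D.Z n = ∑ t ∈ Φ, D.galPt t (.some x₀ y₀ h₀)) (hcard : Φ.card = gK n)
    (hnc : ∀ t ∈ Φ, ¬ ((2 : ℕ) • D.galPt t (.some x₀ y₀ h₀) = 0 ∨ (2 : ℕ) • D.galPt t (.some x₀ y₀ h₀) = tauOne))
    {X Y : ℚ} (h : (Atwo n).toAffine.Nonsingular X Y) (hX : ¬ ∃ s : ℚ, X = 2 * s ^ 2)
    (hgen : ∀ P : (Atwo n).toAffine.Point, ∃ m : ℤ, IsOfFinAddOrder (P - m • (Point.some X Y h : (Atwo n).toAffine.Point))) :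
    ¬ ∃ y : APoint D.H, IsOfFinAddOrder (D.Z n - (2 : ℤ) • y) := by
  have hmod8 : n % 8 = 5 := by rw [hn, Nat.mul_mod, hl8, hm8]
  have hodd : Odd n := Nat.odd_iff.mpr (by omega)
  have hns := hLaw n l m hl hm hl8 hm8 hn hr h₂ h₄ D hPr hC h₀ Φ hG1 hcard hnc h hX hgen
  exact GenusPointHalfTraceClass.genusPoint_not_twoDivisible_of_prod D hodd hPr.2.2.2.2.2.2.2.2.1 h₀ Φ hG1 hnc hns

end Summit.BirchSwinnertonDyer.PrintCf2.LevelTwo.GenusPeriodLaws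

end
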